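import Literature.Probability.Percolation.SiteIfaceSector
import Literature.Probability.Percolation.FlipFourArm
import HarnessLib

/-!
# Periodic enumeration of the hexagonal rings `∂Λ_k`, rim–ring adjacency, and the faces on a ring bond

Topic `Literature/Probability/Percolation`; family `crit-perc`. Lattice-geometric groundwork for the
colour-exchange flip explored FROM THE INNER BOUNDARY of an annulus (`InnerFlipFourArm.lean`: the
comparison `π₄(r₀, N) ≤ C(r₀) · P_{1/2}(altFourArm r₀ N)` of the order-free and the alternating
four-arm events from a FIXED inner radius, the "bridge" of the alternating route to Kesten's
scaling relation, P. Nolin, *Near-critical percolation in two dimensions*, Electron. J. Probab. 13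
(2008), §5.1 Prop. 20 [arXiv 0711.4948: Prop. 19] and §7.3 Prop. 34 [arXiv Prop. 32]). Everything
here is elementary bookkeeping on the rings `∂Λ_k = {|·|_𝕋 = k}` of the triangular lattice:

* `rp k i` — **the periodic enumeration of `∂Λ_k`**: `ringPt k (i mod 6k)` (`ringPt` of
  `SiteIfaceSector.lean` enumerates the `6k` sites anticlockwise from the corner `(k, -k)`);
  norm `k`, consecutive sites adjacent (also across the index `6k ≡ 0`), period `6k`,
  injectivity modulo `6k`; `exists_eq_ringPt` — every site of norm `k` is `ringPt k (c k + t)`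
  with `c < 6`, `t < k` (side and position on the side);
* **rim–ring adjacency** between `∂Λ_R` and `∂Λ_{R-1}` in these coordinates: the site
  `ringPt R (c R + t)` is adjacent to `ringPt (R-1) (c (R-1) + t - 1)` (`t ≥ 1`) and to
  `ringPt (R-1) (c (R-1) + t)`; conversely the sites of norm `R` adjacent to a ring site are two or
  three explicit rim sites (`rim_of_adj_ring`);
* **the two faces on a ring bond**: for consecutive ring sites `u = ringPt k i`, `v = ringPt k (i+1)`
  the apex `triLeftApex v u` (third vertex of the face to the left of the dart `v → u`, i.e. to the
  RIGHT of the anticlockwise bond) has norm `k + 1` and the apex `triLeftApex u v` has norm `k - 1`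
  (`triNorm_triLeftApex_ringPt_succ`, `…_symm`); the two common neighbours of the endpoints of a
  bond are these two apices (`eq_triLeftApex_or_of_adj`).

## References

* P. Nolin, *Near-critical percolation in two dimensions*, Electron. J. Probab. 13 (2008), §5.1
  Prop. 20 (arXiv 0711.4948: Prop. 19) [Nolin2008].
* B. Bollobás, O. Riordan, *Percolation*, CUP (2006), Ch. 7 §7.2.3 pp. 173–175 [BollobasRiordan2006].

## Mathlib / tree

Tree: `ringPt`, `ringPt_spec`, `triNorm_ringPt`, `ringPt_adj`, `ringPt_injOn`
(`SiteIfaceSector.lean`); `triLeftApex` (`TriDiscreteDomain.lean`); `triGraph_adj_iff_coord`,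
`triRot60_apply_zero/one` (`TriAnnulusCircuit.lean`); `triNorm_eq_of_apply_eq`. Mathlib: `Nat.mod` API.
-/

noncomputable section

open Finset

namespace Literature.Probability.Percolation

open LatticeModels

/-! ### The periodic ring enumeration -/

/-- **The periodic enumeration of the ring `∂Λ_k`**: `rp k i = ringPt k (i mod 6k)`. [folklore] -/
def rp (k i : ℕ) : Site 2 := ringPt k (i % (6 * k))

/-- Below `6k` the periodic enumeration is `ringPt`. [folklore] -/
theorem rp_of_lt {k i : ℕ} (hi : i < 6 * k) : rp k i = ringPt k i := by
  rw [rp, Nat.mod_eq_of_lt hi]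

/-- The enumeration `ringPt` itself returns to its start at the index `6k`. [folklore] -/
theorem ringPt_six_mul (k : ℕ) : ringPt k (6 * k) = ringPt k 0 := by
  have h0 : ringPt k (6 * k) 0 = k ∧ ringPt k (6 * k) 1 = -(k : ℤ) := by
    rcases ringPt_spec k (6 * k) with h | h | h | h | h | h <;> omega
  have h1 : ringPt k 0 0 = k ∧ ringPt k 0 1 = -(k : ℤ) := by
    rcases ringPt_spec k 0 with h | h | h | h | h | h <;> omega
  ext j; fin_cases j
  · exact h0.1.trans h1.1.symm
  · exact h0.2.trans h1.2.symm

/-- Period `6k`. [folklore] -/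
theorem rp_add_period (k i : ℕ) : rp k (i + 6 * k) = rp k i := by
  simp [rp]

/-- Period `6k`, multiples. [folklore] -/
theorem rp_add_mul_period (k i m : ℕ) : rp k (i + m * (6 * k)) = rp k i := by
  simp [rp]

/-- **Ring sites have norm `k`** (`k ≥ 1`). [folklore] -/
theorem triNorm_rp {k : ℕ} (hk : 1 ≤ k) (i : ℕ) : triNorm (rp k i) = k :=
  triNorm_ringPt (Nat.mod_lt _ (by omega)).le

/-- **Consecutive ring sites are adjacent**, including across the index `6k ≡ 0`. [folklore] -/
theorem rp_adj {k : ℕ} (hk : 1 ≤ k) (i : ℕ) : triGraph.Adj (rp k i) (rp k (i + 1)) := by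
  have hP : 0 < 6 * k := by omega
  have hlt : i % (6 * k) < 6 * k := Nat.mod_lt _ hP
  unfold rp
  by_cases h : i % (6 * k) + 1 < 6 * k
  · have : (i + 1) % (6 * k) = i % (6 * k) + 1 := by
      rw [Nat.add_mod, Nat.one_mod_eq_one.2 (by omega), Nat.mod_eq_of_lt h]
    rw [this]
    exact ringPt_adj hk _
  · have h1 : i % (6 * k) = 6 * k - 1 := by omega
    have h2 : (i + 1) % (6 * k) = 0 := by
      rw [Nat.add_mod, h1, Nat.one_mod_eq_one.2 (by omega), Nat.sub_add_cancel (by omega), Nat.mod_self]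
    rw [h1, h2, ← ringPt_six_mul k]
    have := ringPt_adj hk (6 * k - 1)
    rwa [Nat.sub_add_cancel (by omega)] at this

/-- Consecutive ring sites are adjacent (reverse orientation). [folklore] -/
theorem rp_adj' {k : ℕ} (hk : 1 ≤ k) (i : ℕ) : triGraph.Adj (rp k (i + 1)) (rp k i) := (rp_adj hk i).symm

/-- **Injectivity modulo the period.** [folklore] -/
theorem rp_eq_rp_iff {k : ℕ} (hk : 1 ≤ k) {i j : ℕ} : rp k i = rp k j ↔ i % (6 * k) = j % (6 * k) := by
  refine ⟨fun h => ringPt_injOn (Nat.mod_lt _ (by omega)) (Nat.mod_lt _ (by omega)) h, fun h => ?_⟩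
  unfold rp; rw [h]

/-- Distinct indices less than a period apart give distinct ring sites. [folklore] -/
theorem rp_ne_rp_of_lt {k : ℕ} (hk : 1 ≤ k) {i j : ℕ} (hij : i < j) (hj : j < i + 6 * k) : rp k i ≠ rp k j := by
  intro h
  rw [rp_eq_rp_iff hk] at h
  have h0 : (j - i) % (6 * k) = 0 := Nat.sub_mod_eq_zero_of_mod_eq h.symm
  have hdvd : 6 * k ∣ j - i := Nat.dvd_of_mod_eq_zero h0
  have hle : 6 * k ≤ j - i := Nat.le_of_dvd (by omega) hdvd
  omega

/-! ### Every ring site is enumerated: side and position -/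

set_option maxHeartbeats 800000 in
/-- **Every site of norm `k ≥ 1` is `ringPt k (c k + t)` with `c < 6` and `t < k`** (`c` the side,
anticlockwise from `x₀ = k`, and `t` the position on it). [folklore] -/
theorem exists_eq_ringPt {k : ℕ} (hk : 1 ≤ k) {v : Site 2} (hv : triNorm v = k) :
    ∃ c < 6, ∃ t < k, v = ringPt k (c * k + t) := by
  have hn := triNorm_eq_of_apply_eq (y := v) rfl rfl
  rw [hv] at hn
  have key : (v 0 = k ∧ -(k : ℤ) ≤ v 1 ∧ v 1 < 0) ∨ (v 0 + v 1 = k ∧ 0 < v 0 ∧ v 0 ≤ k) ∨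
      (v 1 = k ∧ -(k : ℤ) < v 0 ∧ v 0 ≤ 0) ∨ (v 0 = -(k : ℤ) ∧ 0 < v 1 ∧ v 1 ≤ k) ∨
      (v 0 + v 1 = -(k : ℤ) ∧ -(k : ℤ) ≤ v 0 ∧ v 0 < 0) ∨ (v 1 = -(k : ℤ) ∧ 0 ≤ v 0 ∧ v 0 < k) := by
    omega
  clear hn hv
  -- in each case the index is `c k + t` with `t` read off the coordinates
  have conclude : ∀ (c t : ℕ), c < 6 → t < k → ringPt k (c * k + t) 0 = v 0 → ringPt k (c * k + t) 1 = v 1 →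
      ∃ c < 6, ∃ t < k, v = ringPt k (c * k + t) := by
    intro c t hc ht e0 e1
    refine ⟨c, hc, t, ht, ?_⟩
    ext j; fin_cases j
    · exact e0.symm
    · exact e1.symm
  rcases key with ⟨h0, h1, h2⟩ | ⟨h0, h1, h2⟩ | ⟨h0, h1, h2⟩ | ⟨h0, h1, h2⟩ | ⟨h0, h1, h2⟩ | ⟨h0, h1, h2⟩
  · obtain ⟨t, ht⟩ : ∃ t : ℕ, (t : ℤ) = v 1 + k := ⟨_, Int.toNat_of_nonneg (by omega)⟩
    refine conclude 0 t (by norm_num) (by omega) ?_ ?_ <;>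
      rcases ringPt_spec k (0 * k + t) with h | h | h | h | h | h <;> omega
  · obtain ⟨t, ht⟩ : ∃ t : ℕ, (t : ℤ) = k - v 0 := ⟨_, Int.toNat_of_nonneg (by omega)⟩
    refine conclude 1 t (by norm_num) (by omega) ?_ ?_ <;>
      rcases ringPt_spec k (1 * k + t) with h | h | h | h | h | h <;> omega
  · obtain ⟨t, ht⟩ : ∃ t : ℕ, (t : ℤ) = -v 0 := ⟨_, Int.toNat_of_nonneg (by omega)⟩
    refine conclude 2 t (by norm_num) (by omega) ?_ ?_ <;>
      rcases ringPt_spec k (2 * k + t) with h | h | h | h | h | h <;> omega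
  · obtain ⟨t, ht⟩ : ∃ t : ℕ, (t : ℤ) = k - v 1 := ⟨_, Int.toNat_of_nonneg (by omega)⟩
    refine conclude 3 t (by norm_num) (by omega) ?_ ?_ <;>
      rcases ringPt_spec k (3 * k + t) with h | h | h | h | h | h <;> omega
  · obtain ⟨t, ht⟩ : ∃ t : ℕ, (t : ℤ) = v 0 + k := ⟨_, Int.toNat_of_nonneg (by omega)⟩
    refine conclude 4 t (by norm_num) (by omega) ?_ ?_ <;>
      rcases ringPt_spec k (4 * k + t) with h | h | h | h | h | h <;> omega
  · obtain ⟨t, ht⟩ : ∃ t : ℕ, (t : ℤ) = v 0 := ⟨_, Int.toNat_of_nonneg (by omega)⟩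
    refine conclude 5 t (by norm_num) (by omega) ?_ ?_ <;>
      rcases ringPt_spec k (5 * k + t) with h | h | h | h | h | h <;> omega

/-- Every site of norm `k ≥ 1` is some `rp k i` with `i < 6k`. [folklore] -/
theorem exists_eq_rp {k : ℕ} (hk : 1 ≤ k) {v : Site 2} (hv : triNorm v = k) : ∃ i < 6 * k, v = rp k i := by
  obtain ⟨c, hc, t, ht, rfl⟩ := exists_eq_ringPt hk hv
  have hlt : c * k + t < 6 * k := by nlinarith
  exact ⟨c * k + t, hlt, (rp_of_lt hlt).symm⟩

/-- A site with the coordinates of `ringPt k i` is that site. [folklore] -/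
theorem eq_ringPt_of_apply {k i : ℕ} {b : Site 2} (h0 : b 0 = ringPt k i 0) (h1 : b 1 = ringPt k i 1) :
    b = ringPt k i := by
  ext j; fin_cases j
  · exact h0
  · exact h1

/-! ### Rim–ring adjacency between `∂Λ_R` and `∂Λ_{R-1}` -/

set_option maxHeartbeats 2000000 in
/-- **The rim site `ringPt R (c R + t)` is adjacent to the ring site `ringPt (R-1) (c (R-1) + t)`**
(`c < 6`, `t < R`, `R ≥ 2`). [folklore] -/
theorem ringPt_adj_ringPt_pred_hi {R c t : ℕ} (hR : 2 ≤ R) (hc : c < 6) (ht : t < R) :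
    triGraph.Adj (ringPt R (c * R + t)) (ringPt (R - 1) (c * (R - 1) + t)) := by
  have h1 := ringPt_spec R (c * R + t)
  have h2 := ringPt_spec (R - 1) (c * (R - 1) + t)
  rw [triGraph_adj_iff_coord]
  interval_cases c <;> (rcases h1 with h | h | h | h | h | h <;> try (exfalso; omega)) <;>
    (rcases h2 with h' | h' | h' | h' | h' | h' <;> try (exfalso; omega)) <;> omega

set_option maxHeartbeats 2000000 in
/-- **The rim site `ringPt R (c R + t)`, `t ≥ 1`, is adjacent to the ring site
`ringPt (R-1) (c (R-1) + t - 1)`** (`c < 6`, `t < R`, `R ≥ 2`). [folklore] -/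
theorem ringPt_adj_ringPt_pred_lo {R c t : ℕ} (hR : 2 ≤ R) (hc : c < 6) (ht1 : 1 ≤ t) (ht : t < R) :
    triGraph.Adj (ringPt R (c * R + t)) (ringPt (R - 1) (c * (R - 1) + t - 1)) := by
  have h1 := ringPt_spec R (c * R + t)
  have h2 := ringPt_spec (R - 1) (c * (R - 1) + t - 1)
  rw [triGraph_adj_iff_coord]
  interval_cases c <;> (rcases h1 with h | h | h | h | h | h <;> try (exfalso; omega)) <;>
    (rcases h2 with h' | h' | h' | h' | h' | h' <;> try (exfalso; omega)) <;> omega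

set_option maxHeartbeats 1600000 in
/-- **The sites of norm `R` adjacent to a ring site.** If `b` has norm `R` and is adjacent to the
ring site `ringPt (R-1) (c (R-1) + t)` (`c < 6`, `t < R - 1`), then: for `t ≥ 1`, `b` is one of the two
rim sites `ringPt R (c R + t)`, `ringPt R (c R + t + 1)`; for `t = 0` (a corner of the ring), `b` is
one of the three rim sites `rp R (c R + 6R - 1)`, `ringPt R (c R)` (the rim corner), `ringPt R (c R + 1)`.
[folklore] -/
theorem rim_of_adj_ring {R c t : ℕ} (hR : 2 ≤ R) (hc : c < 6) (ht : t < R - 1) {b : Site 2}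
    (hb : triNorm b = R) (hadj : triGraph.Adj b (ringPt (R - 1) (c * (R - 1) + t))) :
    (1 ≤ t ∧ (b = ringPt R (c * R + t) ∨ b = ringPt R (c * R + t + 1))) ∨
      (t = 0 ∧ (b = rp R (c * R + 6 * R - 1) ∨ b = ringPt R (c * R) ∨ b = ringPt R (c * R + 1))) := by
  have hn := triNorm_eq_of_apply_eq (y := b) rfl rfl
  rw [hb] at hn
  rw [triGraph_adj_iff_coord] at hadj
  -- the previous rim site, for the corner case
  have hprev : ∀ c' < 6, rp R (c' * R + 6 * R - 1) = ringPt R (if c' = 0 then 6 * R - 1 else c' * R - 1) := by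
    intro c' hc'
    split_ifs with h0
    · subst h0; rw [rp_of_lt (by omega)]; congr 1; omega
    · have : c' * R + 6 * R - 1 = (c' * R - 1) + 1 * (6 * R) := by
        have : 1 ≤ c' * R := Nat.one_le_iff_ne_zero.2 (by positivity)
        omega
      rw [this, rp_add_mul_period, rp_of_lt]
      have : c' * R ≤ 5 * R := Nat.mul_le_mul_right _ (by omega)
      omega
  rw [hprev c hc]
  interval_cases c
  · rcases ringPt_spec (R - 1) (0 * (R - 1) + t) with h' | h' | h' | h' | h' | h' <;> [skip; omega; omega; omega; omega; omega]
    rcases Nat.eq_zero_or_pos t with rfl | ht1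
    · right; refine ⟨rfl, ?_⟩
      have key : (b 0 = R ∧ b 1 = -(R : ℤ) + 1) ∨ (b 0 = R ∧ b 1 = -(R : ℤ)) ∨ (b 0 = R - 1 ∧ b 1 = -(R : ℤ)) := by omega
      clear hn
      simp only [if_true]
      rcases key with ⟨e0, e1⟩ | ⟨e0, e1⟩ | ⟨e0, e1⟩
      · right; right; apply eq_ringPt_of_apply <;>
          rcases ringPt_spec R (0 * R + 1) with h | h | h | h | h | h <;> omega
      · right; left; apply eq_ringPt_of_apply <;>
          rcases ringPt_spec R (0 * R) with h | h | h | h | h | h <;> omega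
      · left; apply eq_ringPt_of_apply <;>
          rcases ringPt_spec R (6 * R - 1) with h | h | h | h | h | h <;> omega
    · left; refine ⟨ht1, ?_⟩
      have key : (b 0 = R ∧ b 1 = (t : ℤ) - R) ∨ (b 0 = R ∧ b 1 = (t : ℤ) + 1 - R) := by omega
      clear hn
      rcases key with ⟨e0, e1⟩ | ⟨e0, e1⟩
      · left; apply eq_ringPt_of_apply <;>
          rcases ringPt_spec R (0 * R + t) with h | h | h | h | h | h <;> omega
      · right; apply eq_ringPt_of_apply <;>
          rcases ringPt_spec R (0 * R + t + 1) with h | h | h | h | h | h <;> omega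
  · rcases ringPt_spec (R - 1) (1 * (R - 1) + t) with h' | h' | h' | h' | h' | h' <;> [skip; skip; omega; omega; omega; omega]
    · -- `t = 0`: the corner `(R-1, 0)`
      have ht0 : t = 0 := by omega
      subst ht0
      right; refine ⟨rfl, ?_⟩
      have key : (b 0 = R ∧ b 1 = -1) ∨ (b 0 = R ∧ b 1 = 0) ∨ (b 0 = R - 1 ∧ b 1 = 1) := by omega
      clear hn
      simp only [show (1 : ℕ) ≠ 0 from one_ne_zero, if_false]
      rcases key with ⟨e0, e1⟩ | ⟨e0, e1⟩ | ⟨e0, e1⟩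
      · left; apply eq_ringPt_of_apply <;>
          rcases ringPt_spec R (1 * R - 1) with h | h | h | h | h | h <;> omega
      · right; left; apply eq_ringPt_of_apply <;>
          rcases ringPt_spec R (1 * R) with h | h | h | h | h | h <;> omega
      · right; right; apply eq_ringPt_of_apply <;>
          rcases ringPt_spec R (1 * R + 1) with h | h | h | h | h | h <;> omega
    · have ht1 : 1 ≤ t := by omega
      left; refine ⟨ht1, ?_⟩
      have key : (b 0 = R - t ∧ b 1 = t) ∨ (b 0 = (R : ℤ) - t - 1 ∧ b 1 = (t : ℤ) + 1) := by omega
      clear hn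
      rcases key with ⟨e0, e1⟩ | ⟨e0, e1⟩
      · left; apply eq_ringPt_of_apply <;>
          rcases ringPt_spec R (1 * R + t) with h | h | h | h | h | h <;> omega
      · right; apply eq_ringPt_of_apply <;>
          rcases ringPt_spec R (1 * R + t + 1) with h | h | h | h | h | h <;> omega
  · rcases ringPt_spec (R - 1) (2 * (R - 1) + t) with h' | h' | h' | h' | h' | h' <;> [omega; skip; skip; omega; omega; omega]
    · have ht0 : t = 0 := by omega
      subst ht0
      right; refine ⟨rfl, ?_⟩
      have key : (b 0 = 1 ∧ b 1 = (R : ℤ) - 1) ∨ (b 0 = 0 ∧ b 1 = R) ∨ (b 0 = -1 ∧ b 1 = R) := by omega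
      clear hn
      simp only [show (2 : ℕ) ≠ 0 from two_ne_zero, if_false]
      rcases key with ⟨e0, e1⟩ | ⟨e0, e1⟩ | ⟨e0, e1⟩
      · left; apply eq_ringPt_of_apply <;>
          rcases ringPt_spec R (2 * R - 1) with h | h | h | h | h | h <;> omega
      · right; left; apply eq_ringPt_of_apply <;>
          rcases ringPt_spec R (2 * R) with h | h | h | h | h | h <;> omega
      · right; right; apply eq_ringPt_of_apply <;>
          rcases ringPt_spec R (2 * R + 1) with h | h | h | h | h | h <;> omega
    · have ht1 : 1 ≤ t := by omega
      left; refine ⟨ht1, ?_⟩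
      have key : (b 0 = -(t : ℤ) ∧ b 1 = R) ∨ (b 0 = -(t : ℤ) - 1 ∧ b 1 = R) := by omega
      clear hn
      rcases key with ⟨e0, e1⟩ | ⟨e0, e1⟩
      · left; apply eq_ringPt_of_apply <;>
          rcases ringPt_spec R (2 * R + t) with h | h | h | h | h | h <;> omega
      · right; apply eq_ringPt_of_apply <;>
          rcases ringPt_spec R (2 * R + t + 1) with h | h | h | h | h | h <;> omega
  · rcases ringPt_spec (R - 1) (3 * (R - 1) + t) with h' | h' | h' | h' | h' | h' <;> [omega; omega; skip; skip; omega; omega]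
    · have ht0 : t = 0 := by omega
      subst ht0
      right; refine ⟨rfl, ?_⟩
      have key : (b 0 = -(R : ℤ) + 1 ∧ b 1 = R) ∨ (b 0 = -(R : ℤ) ∧ b 1 = R) ∨ (b 0 = -(R : ℤ) ∧ b 1 = (R : ℤ) - 1) := by omega
      clear hn
      simp only [show (3 : ℕ) ≠ 0 from three_ne_zero, if_false]
      rcases key with ⟨e0, e1⟩ | ⟨e0, e1⟩ | ⟨e0, e1⟩
      · left; apply eq_ringPt_of_apply <;>
          rcases ringPt_spec R (3 * R - 1) with h | h | h | h | h | h <;> omega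
      · right; left; apply eq_ringPt_of_apply <;>
          rcases ringPt_spec R (3 * R) with h | h | h | h | h | h <;> omega
      · right; right; apply eq_ringPt_of_apply <;>
          rcases ringPt_spec R (3 * R + 1) with h | h | h | h | h | h <;> omega
    · have ht1 : 1 ≤ t := by omega
      left; refine ⟨ht1, ?_⟩
      have key : (b 0 = -(R : ℤ) ∧ b 1 = (R : ℤ) - t) ∨ (b 0 = -(R : ℤ) ∧ b 1 = (R : ℤ) - t - 1) := by omega
      clear hn
      rcases key with ⟨e0, e1⟩ | ⟨e0, e1⟩
      · left; apply eq_ringPt_of_apply <;>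
          rcases ringPt_spec R (3 * R + t) with h | h | h | h | h | h <;> omega
      · right; apply eq_ringPt_of_apply <;>
          rcases ringPt_spec R (3 * R + t + 1) with h | h | h | h | h | h <;> omega
  · rcases ringPt_spec (R - 1) (4 * (R - 1) + t) with h' | h' | h' | h' | h' | h' <;> [omega; omega; omega; skip; skip; omega]
    · have ht0 : t = 0 := by omega
      subst ht0
      right; refine ⟨rfl, ?_⟩
      have key : (b 0 = -(R : ℤ) ∧ b 1 = 1) ∨ (b 0 = -(R : ℤ) ∧ b 1 = 0) ∨ (b 0 = -(R : ℤ) + 1 ∧ b 1 = -1) := by omega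
      clear hn
      simp only [show (4 : ℕ) ≠ 0 from four_ne_zero, if_false]
      rcases key with ⟨e0, e1⟩ | ⟨e0, e1⟩ | ⟨e0, e1⟩
      · left; apply eq_ringPt_of_apply <;>
          rcases ringPt_spec R (4 * R - 1) with h | h | h | h | h | h <;> omega
      · right; left; apply eq_ringPt_of_apply <;>
          rcases ringPt_spec R (4 * R) with h | h | h | h | h | h <;> omega
      · right; right; apply eq_ringPt_of_apply <;>
          rcases ringPt_spec R (4 * R + 1) with h | h | h | h | h | h <;> omega
    · have ht1 : 1 ≤ t := by omega
      left; refine ⟨ht1, ?_⟩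
      have key : (b 0 = -(R : ℤ) + t ∧ b 1 = -(t : ℤ)) ∨ (b 0 = -(R : ℤ) + t + 1 ∧ b 1 = -(t : ℤ) - 1) := by omega
      clear hn
      rcases key with ⟨e0, e1⟩ | ⟨e0, e1⟩
      · left; apply eq_ringPt_of_apply <;>
          rcases ringPt_spec R (4 * R + t) with h | h | h | h | h | h <;> omega
      · right; apply eq_ringPt_of_apply <;>
          rcases ringPt_spec R (4 * R + t + 1) with h | h | h | h | h | h <;> omega
  · rcases ringPt_spec (R - 1) (5 * (R - 1) + t) with h' | h' | h' | h' | h' | h' <;> [omega; omega; omega; omega; skip; skip]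
    · have ht0 : t = 0 := by omega
      subst ht0
      right; refine ⟨rfl, ?_⟩
      have key : (b 0 = -1 ∧ b 1 = -(R : ℤ) + 1) ∨ (b 0 = 0 ∧ b 1 = -(R : ℤ)) ∨ (b 0 = 1 ∧ b 1 = -(R : ℤ)) := by omega
      clear hn
      simp only [show (5 : ℕ) ≠ 0 by norm_num, if_false]
      rcases key with ⟨e0, e1⟩ | ⟨e0, e1⟩ | ⟨e0, e1⟩
      · left; apply eq_ringPt_of_apply <;>
          rcases ringPt_spec R (5 * R - 1) with h | h | h | h | h | h <;> omega
      · right; left; apply eq_ringPt_of_apply <;>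
          rcases ringPt_spec R (5 * R) with h | h | h | h | h | h <;> omega
      · right; right; apply eq_ringPt_of_apply <;>
          rcases ringPt_spec R (5 * R + 1) with h | h | h | h | h | h <;> omega
    · have ht1 : 1 ≤ t := by omega
      left; refine ⟨ht1, ?_⟩
      have key : (b 0 = (t : ℤ) ∧ b 1 = -(R : ℤ)) ∨ (b 0 = (t : ℤ) + 1 ∧ b 1 = -(R : ℤ)) := by omega
      clear hn
      rcases key with ⟨e0, e1⟩ | ⟨e0, e1⟩
      · left; apply eq_ringPt_of_apply <;>
          rcases ringPt_spec R (5 * R + t) with h | h | h | h | h | h <;> omega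
      · right; apply eq_ringPt_of_apply <;>
          rcases ringPt_spec R (5 * R + t + 1) with h | h | h | h | h | h <;> omega

/-! ### The two faces on a ring bond -/

open TriMarkedDomain (fin3_add_one_add_one fin3_add_one_add_two fin3_add_two_add_one fin3_add_two_add_two
  adj_faceVertex_succ)

/-- Coordinates of the apex `triLeftApex u v = u + ρ_{60°}(v - u)`. [folklore] -/
theorem triLeftApex_apply (u v : Site 2) :
    triLeftApex u v 0 = u 0 + u 1 - v 1 ∧ triLeftApex u v 1 = v 0 + v 1 - u 0 := by
  simp only [triLeftApex, Pi.add_apply, triRot60_apply_zero, triRot60_apply_one, Pi.sub_apply]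
  constructor <;> ring

/-- The successor in the periodic enumeration, through `ringPt`. [folklore] -/
theorem rp_succ_eq {k : ℕ} (hk : 1 ≤ k) (i : ℕ) : rp k (i + 1) = ringPt k (i % (6 * k) + 1) := by
  have hP : 0 < 6 * k := by omega
  unfold rp
  by_cases h : i % (6 * k) + 1 < 6 * k
  · rw [Nat.add_mod, Nat.one_mod_eq_one.2 (by omega), Nat.mod_eq_of_lt h]
  · have h1 : i % (6 * k) = 6 * k - 1 := by have := Nat.mod_lt i hP; omega
    have h2 : (i + 1) % (6 * k) = 0 := by
      rw [Nat.add_mod, h1, Nat.one_mod_eq_one.2 (by omega), Nat.sub_add_cancel (by omega), Nat.mod_self]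
    rw [h2, h1, Nat.sub_add_cancel (by omega), ringPt_six_mul]

set_option maxHeartbeats 2000000 in
/-- **The outward apex of a ring bond**: for `i < 6k` (`k ≥ 1`) the apex of the dart
`ringPt k (i+1) → ringPt k i` has norm `k + 1`. [folklore] -/
theorem triNorm_triLeftApex_ringPt_out {k i : ℕ} (hk : 1 ≤ k) (hi : i < 6 * k) :
    triNorm (triLeftApex (ringPt k (i + 1)) (ringPt k i)) = k + 1 := by
  obtain ⟨a0, a1⟩ := triLeftApex_apply (ringPt k (i + 1)) (ringPt k i)
  have hn := triNorm_eq_of_apply_eq a0 a1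
  have h1 := ringPt_spec k i
  have h2 := ringPt_spec k (i + 1)
  rcases h1 with h | h | h | h | h | h <;> (rcases h2 with h' | h' | h' | h' | h' | h' <;> try (exfalso; omega)) <;> omega

set_option maxHeartbeats 2000000 in
/-- **The inward apex of a ring bond**: for `i < 6k` (`k ≥ 1`) the apex of the dart
`ringPt k i → ringPt k (i+1)` has norm `k - 1`. [folklore] -/
theorem triNorm_triLeftApex_ringPt_in {k i : ℕ} (hk : 1 ≤ k) (hi : i < 6 * k) :
    triNorm (triLeftApex (ringPt k i) (ringPt k (i + 1))) = k - 1 := by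
  obtain ⟨a0, a1⟩ := triLeftApex_apply (ringPt k i) (ringPt k (i + 1))
  have hn := triNorm_eq_of_apply_eq a0 a1
  have h1 := ringPt_spec k i
  have h2 := ringPt_spec k (i + 1)
  rcases h1 with h | h | h | h | h | h <;> (rcases h2 with h' | h' | h' | h' | h' | h' <;> try (exfalso; omega)) <;> omega

/-- The outward apex of a bond of the periodic enumeration has norm `k + 1`. [folklore] -/
theorem triNorm_triLeftApex_rp_out {k : ℕ} (hk : 1 ≤ k) (i : ℕ) :
    triNorm (triLeftApex (rp k (i + 1)) (rp k i)) = k + 1 := by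
  rw [rp_succ_eq hk]
  exact triNorm_triLeftApex_ringPt_out hk (Nat.mod_lt _ (by omega))

/-- The inward apex of a bond of the periodic enumeration has norm `k - 1`. [folklore] -/
theorem triNorm_triLeftApex_rp_in {k : ℕ} (hk : 1 ≤ k) (i : ℕ) :
    triNorm (triLeftApex (rp k i) (rp k (i + 1))) = k - 1 := by
  rw [rp_succ_eq hk]
  exact triNorm_triLeftApex_ringPt_in hk (Nat.mod_lt _ (by omega))

set_option maxHeartbeats 2000000 in
/-- **The common neighbours of the endpoints of a bond are its two apices.** [folklore] -/
theorem eq_triLeftApex_or_of_adj {u v w : Site 2} (huv : triGraph.Adj u v) (hwu : triGraph.Adj w u)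
    (hwv : triGraph.Adj w v) : w = triLeftApex u v ∨ w = triLeftApex v u := by
  obtain ⟨a0, a1⟩ := triLeftApex_apply u v
  obtain ⟨b0, b1⟩ := triLeftApex_apply v u
  rw [triGraph_adj_iff_coord] at huv hwu hwv
  have key : (w 0 = u 0 + u 1 - v 1 ∧ w 1 = v 0 + v 1 - u 0) ∨ (w 0 = v 0 + v 1 - u 1 ∧ w 1 = u 0 + u 1 - v 0) := by
    omega
  rcases key with ⟨h0, h1⟩ | ⟨h0, h1⟩
  · left; ext j; fin_cases j
    · exact h0.trans a0.symm
    · exact h1.trans a1.symm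
  · right; ext j; fin_cases j
    · exact h0.trans b0.symm
    · exact h1.trans b1.symm

/-- **The face across a side contains the other apex**: a site adjacent to both endpoints
`faceVertex F (j+1)`, `faceVertex F (j+2)` of the side `j` of `F` and different from the vertex
`faceVertex F j` is the apex `faceVertex (oppFace F j) (oppIdx F j)` of the face across that side. [folklore] -/
theorem eq_faceVertex_oppFace_of_adj {F : HexVertex} {j : Fin 3} {z : Site 2}
    (h1 : triGraph.Adj z (faceVertex F (j + 1))) (h2 : triGraph.Adj z (faceVertex F (j + 2)))
    (hne : z ≠ faceVertex F j) : z = faceVertex (oppFace F j) (oppIdx F j) := by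
  have hadj : triGraph.Adj (faceVertex F (j + 1)) (faceVertex F (j + 2)) := by
    have := adj_faceVertex_succ F (j + 1); rwa [fin3_add_one_add_one] at this
  rcases eq_triLeftApex_or_of_adj hadj h1 h2 with h | h
  · have e := triLeftApex_faceVertex F (j + 1)
    rw [fin3_add_one_add_one, fin3_add_one_add_two] at e
    exact absurd (h.trans e) hne
  · have e := triLeftApex_faceVertex (oppFace F j) (oppIdx F j + 1)
    rw [fin3_add_one_add_one, fin3_add_one_add_two, faceVertex_oppFace_succ, faceVertex_oppFace_succ_succ] at e
    exact h.trans e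

/-- The apex of the face across the side `j` of `F` is a vertex of that face (membership form). [folklore] -/
theorem mem_hexFaceVertices_oppFace_of_adj {F : HexVertex} {j : Fin 3} {z : Site 2}
    (h1 : triGraph.Adj z (faceVertex F (j + 1))) (h2 : triGraph.Adj z (faceVertex F (j + 2)))
    (hne : z ≠ faceVertex F j) : z ∈ hexFaceVertices (oppFace F j) := by
  rw [eq_faceVertex_oppFace_of_adj h1 h2 hne]; exact faceVertex_mem _ _

/-- **The outward face of the ring bond `(rp k (i+1), rp k i)`**: the face to the left of the dart
from `rp k (i+1)` to `rp k i` (to the right of the anticlockwise bond). [folklore] -/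
def outFace (k i : ℕ) : HexVertex := leftFace (rp k (i + 1)) (rp k i)

/-- The label of `rp k (i+1)` in `outFace k i`. [folklore] -/
def outIdx (k i : ℕ) : Fin 3 := leftFaceIdx (dirOf (rp k (i + 1)) (rp k i))

/-- **The labelled vertices of the outward face**: `rp k (i+1)` at `outIdx`, `rp k i` next. [folklore] -/
theorem faceVertex_outFace {k : ℕ} (hk : 1 ≤ k) (i : ℕ) :
    faceVertex (outFace k i) (outIdx k i) = rp k (i + 1) ∧ faceVertex (outFace k i) (outIdx k i + 1) = rp k i := by
  have hv := eq_add_triDir_dirOf (rp_adj' hk i)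
  unfold outFace outIdx leftFace
  refine ⟨faceVertex_leftFaceDir _ _, ?_⟩
  rw [faceVertex_succ, faceVertex_leftFaceDir, faceDartDir_leftFaceDir]
  exact hv.symm

/-- **The apex of the outward face has norm `k + 1`.** [folklore] -/
theorem triNorm_outFace_apex {k : ℕ} (hk : 1 ≤ k) (i : ℕ) :
    triNorm (faceVertex (outFace k i) (outIdx k i + 2)) = k + 1 := by
  obtain ⟨hj, hj1⟩ := faceVertex_outFace hk i
  have e := triLeftApex_faceVertex (outFace k i) (outIdx k i)
  rw [hj, hj1] at e
  rw [← e]; exact triNorm_triLeftApex_rp_out hk i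

/-- **The apex of the inward face (across the bond, the side `outIdx + 2`) has norm `k - 1`.** [folklore] -/
theorem triNorm_inFace_apex {k : ℕ} (hk : 1 ≤ k) (i : ℕ) :
    triNorm (faceVertex (oppFace (outFace k i) (outIdx k i + 2)) (oppIdx (outFace k i) (outIdx k i + 2))) = k - 1 := by
  obtain ⟨hj, hj1⟩ := faceVertex_outFace hk i
  set F := outFace k i
  set j := outIdx k i
  have e := triLeftApex_faceVertex (oppFace F (j + 2)) (oppIdx F (j + 2) + 1)
  rw [fin3_add_one_add_one, fin3_add_one_add_two, faceVertex_oppFace_succ, faceVertex_oppFace_succ_succ,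
    fin3_add_two_add_two, fin3_add_two_add_one, hj, hj1] at e
  rw [← e]; exact triNorm_triLeftApex_rp_in hk i

/-- **The outward face of a ring bond, as a labelled face** (existential packaging). For `k ≥ 1` and
any index `i` there is a face `F` and a label `j` with `faceVertex F j = rp k (i+1)`,
`faceVertex F (j+1) = rp k i`, whose third vertex `faceVertex F (j+2)` (the outward apex) has norm
`k + 1`, and such that the apex of the face across the bond (the side `j + 2` of `F`) has norm `k - 1`. [folklore] -/
theorem exists_outFace_rp {k : ℕ} (hk : 1 ≤ k) (i : ℕ) :
    ∃ (F : HexVertex) (j : Fin 3), faceVertex F j = rp k (i + 1) ∧ faceVertex F (j + 1) = rp k i ∧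
      triNorm (faceVertex F (j + 2)) = k + 1 ∧
      triNorm (faceVertex (oppFace F (j + 2)) (oppIdx F (j + 2))) = k - 1 :=
  ⟨outFace k i, outIdx k i, (faceVertex_outFace hk i).1, (faceVertex_outFace hk i).2, triNorm_outFace_apex hk i,
    triNorm_inFace_apex hk i⟩

/-! ### A rim site adjacent to a ring site lies over a bond of the ring -/

/-- The predecessor in the periodic enumeration. [folklore] -/
theorem rp_sub_one {k j : ℕ} (hj : 1 ≤ j) : rp k (j - 1) = rp k (j % (6 * k) + 6 * k - 1) := by
  rcases Nat.eq_zero_or_pos k with rfl | hk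
  · simp [rp]
  · have h := Nat.div_add_mod j (6 * k)
    rcases Nat.eq_zero_or_pos (j / (6 * k)) with h0 | hpos
    · rw [h0, mul_zero, zero_add] at h
      conv_lhs => rw [← h]
      rw [show j % (6 * k) + 6 * k - 1 = (j % (6 * k) - 1) + 1 * (6 * k) by omega, rp_add_mul_period]
    · have : j - 1 = (j % (6 * k) + 6 * k - 1) + (j / (6 * k) - 1) * (6 * k) := by
        have h2 : 6 * k * (j / (6 * k)) = 6 * k * (j / (6 * k) - 1) + 6 * k := by
          rw [Nat.mul_sub, mul_one, Nat.sub_add_cancel (Nat.le_mul_of_pos_right _ hpos)]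
        have h3 : (j / (6 * k) - 1) * (6 * k) = 6 * k * (j / (6 * k) - 1) := by ring
        omega
      rw [this, rp_add_mul_period]

/-- Decomposition of an index modulo the period into side and offset. [folklore] -/
theorem exists_side_offset {R : ℕ} (hR : 2 ≤ R) (j : ℕ) :
    ∃ c < 6, ∃ t < R - 1, j % (6 * (R - 1)) = c * (R - 1) + t := by
  have hP : 0 < 6 * (R - 1) := by omega
  have hlt := Nat.mod_lt j hP
  refine ⟨j % (6 * (R - 1)) / (R - 1), ?_, j % (6 * (R - 1)) % (R - 1), Nat.mod_lt _ (by omega), ?_⟩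
  · exact Nat.div_lt_of_lt_mul (by linarith)
  · have := Nat.div_add_mod (j % (6 * (R - 1))) (R - 1); linarith

set_option maxHeartbeats 800000 in
/-- **A rim site adjacent to a ring site lies over a bond of the ring.** If `b` has norm `R ≥ 2` and is
adjacent to the ring site `rp (R-1) j` (`j ≥ 1`), then there are a bond `(i, i+1)` of `∂Λ_{R-1}` with
`i ∈ {j - 1, j}` and its outward apex `x` (the site of norm `R` adjacent to both endpoints) such that
either `b = x`, or — when `b` is a corner of the rim `∂Λ_R` — `b` is adjacent to `x` and to
`rp (R-1) (i+1) = rp (R-1) j` (the hypothesis shape of `SepLoop.W_ne`). [folklore] -/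
theorem overBond_of_adj_ring {R : ℕ} (hR : 2 ≤ R) {b : Site 2} (hb : triNorm b = R) {j : ℕ} (hj : 1 ≤ j)
    (hadj : triGraph.Adj b (rp (R - 1) j)) :
    ∃ (i : ℕ) (x : Site 2), j ≤ i + 1 ∧ i ≤ j ∧ triNorm x = R ∧ triGraph.Adj x (rp (R - 1) i) ∧
      triGraph.Adj x (rp (R - 1) (i + 1)) ∧
      (b = x ∨ (triGraph.Adj b x ∧ triGraph.Adj b (rp (R - 1) (i + 1)) ∧ i + 1 = j)) := by
  have hk : 1 ≤ R - 1 := by omega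
  set P := 6 * (R - 1) with hP
  obtain ⟨c, hc, t, ht, hjct⟩ := exists_side_offset hR j
  have hrpj : rp (R - 1) j = ringPt (R - 1) (c * (R - 1) + t) := by rw [rp, ← hP, hjct]
  rw [hrpj] at hadj
  have hsucc : rp (R - 1) (j + 1) = ringPt (R - 1) (c * (R - 1) + t + 1) := by rw [rp_succ_eq hk, ← hP, hjct]
  -- the predecessor `rp (R-1) (j-1)`
  have hpred : 1 ≤ c * (R - 1) + t → rp (R - 1) (j - 1) = ringPt (R - 1) (c * (R - 1) + t - 1) := by
    intro h1
    rw [rp_sub_one hj, ← hP, hjct, show c * (R - 1) + t + P - 1 = (c * (R - 1) + t - 1) + 1 * (6 * (R - 1)) by omega,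
      rp_add_mul_period, rp_of_lt]
    have : c * (R - 1) ≤ 5 * (R - 1) := Nat.mul_le_mul_right _ (by omega)
    omega
  have hpred0 : c = 0 → t = 0 → rp (R - 1) (j - 1) = ringPt (R - 1) (5 * (R - 1) + (R - 2)) := by
    rintro rfl rfl
    rw [rp_sub_one hj, ← hP, hjct, rp_of_lt (by omega)]
    congr 1; omega
  -- rim sites as `ringPt`
  have hrimprev : ∀ c' < 6, 1 ≤ c' → rp R (c' * R + 6 * R - 1) = ringPt R ((c' - 1) * R + (R - 1)) := by
    intro c' hc' h1
    have e1 : c' * R + 6 * R - 1 = ((c' - 1) * R + (R - 1)) + 1 * (6 * R) := by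
      have : c' * R = (c' - 1) * R + R := by
        rw [Nat.sub_mul, one_mul, Nat.sub_add_cancel (Nat.le_mul_of_pos_left _ h1)]
      omega
    rw [e1, rp_add_mul_period, rp_of_lt]
    have : (c' - 1) * R ≤ 4 * R := Nat.mul_le_mul_right _ (by omega)
    omega
  have hrimprev0 : rp R (0 * R + 6 * R - 1) = ringPt R (5 * R + (R - 1)) := by
    rw [rp_of_lt (by omega)]; congr 1; omega
  rcases rim_of_adj_ring hR hc ht hb hadj with ⟨ht1, rfl | rfl⟩ | ⟨rfl, hb3⟩
  · -- `b = ringPt R (cR + t)`, `t ≥ 1`: over the bond `(j-1, j)`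
    refine ⟨j - 1, ringPt R (c * R + t), by omega, by omega, hb, ?_, ?_, Or.inl rfl⟩
    · rw [hpred (by omega)]; exact ringPt_adj_ringPt_pred_lo hR hc ht1 (by omega)
    · rw [Nat.sub_add_cancel hj, hrpj]; exact ringPt_adj_ringPt_pred_hi hR hc (by omega)
  · -- `b = ringPt R (cR + t + 1)`: over the bond `(j, j+1)`
    refine ⟨j, ringPt R (c * R + t + 1), by omega, le_rfl, hb, ?_, ?_, Or.inl rfl⟩
    · rw [hrpj]
      have := ringPt_adj_ringPt_pred_lo hR hc (t := t + 1) (by omega) (by omega)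
      rwa [show c * R + (t + 1) = c * R + t + 1 by ring, show c * (R - 1) + (t + 1) - 1 = c * (R - 1) + t by omega] at this
    · rw [hsucc]
      have := ringPt_adj_ringPt_pred_hi hR hc (t := t + 1) (by omega)
      rwa [show c * R + (t + 1) = c * R + t + 1 by ring, show c * (R - 1) + (t + 1) = c * (R - 1) + t + 1 by ring] at this
  · -- `t = 0`: the ring corner `ringPt (R-1) (c (R-1))`
    simp only [add_zero] at hrpj hadj hsucc hpred hb3
    -- the previous rim site `x⁻` and its two ring neighbours `(j-1, j)`
    have hxprev : triGraph.Adj (rp R (c * R + 6 * R - 1)) (rp (R - 1) (j - 1)) ∧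
        triGraph.Adj (rp R (c * R + 6 * R - 1)) (rp (R - 1) j) := by
      rcases Nat.eq_zero_or_pos c with rfl | hc1
      · rw [hrimprev0, hpred0 rfl rfl, hrpj]
        refine ⟨?_, ?_⟩
        · have := ringPt_adj_ringPt_pred_lo hR (c := 5) (t := R - 1) (by norm_num) (by omega) (by omega)
          rwa [show 5 * (R - 1) + (R - 1) - 1 = 5 * (R - 1) + (R - 2) by omega] at this
        · have := ringPt_adj_ringPt_pred_hi hR (c := 5) (t := R - 1) (by norm_num) (by omega)
          rwa [show 5 * (R - 1) + (R - 1) = 6 * (R - 1) by ring, ringPt_six_mul, show (0 : ℕ) = 0 * (R - 1) by ring] at this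
      · have h1 : 1 ≤ c * (R - 1) := Nat.one_le_iff_ne_zero.2 (by positivity)
        rw [hrimprev c hc hc1, hpred h1, hrpj]
        have e1 : c * (R - 1) - 1 = (c - 1) * (R - 1) + (R - 1) - 1 := by
          have : c * (R - 1) = (c - 1) * (R - 1) + (R - 1) := by
            rw [Nat.sub_mul, one_mul, Nat.sub_add_cancel (Nat.le_mul_of_pos_left _ hc1)]
          omega
        have e2 : c * (R - 1) = (c - 1) * (R - 1) + (R - 1) := by
          rw [Nat.sub_mul, one_mul, Nat.sub_add_cancel (Nat.le_mul_of_pos_left _ hc1)]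
        refine ⟨?_, ?_⟩
        · rw [e1]; exact ringPt_adj_ringPt_pred_lo hR (by omega) (by omega) (by omega)
        · conv_rhs => rw [e2]
          exact ringPt_adj_ringPt_pred_hi hR (by omega) (by omega)
    rcases hb3 with rfl | rfl | rfl
    · -- `b = x⁻` itself: over the bond `(j-1, j)`
      refine ⟨j - 1, rp R (c * R + 6 * R - 1), by omega, by omega, hb, hxprev.1, ?_, Or.inl rfl⟩
      rw [Nat.sub_add_cancel hj]; exact hxprev.2
    · -- `b` is the rim corner: adjacent to `x⁻` and to `rp j`
      refine ⟨j - 1, rp R (c * R + 6 * R - 1), by omega, by omega, ?_, hxprev.1, ?_, Or.inr ⟨?_, ?_, Nat.sub_add_cancel hj⟩⟩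
      · rw [triNorm_rp (by omega)]
      · rw [Nat.sub_add_cancel hj]; exact hxprev.2
      · have hcR : c * R < 6 * R := (Nat.mul_lt_mul_right (by omega : 0 < R)).2 hc
        have := rp_adj (k := R) (by omega) (c * R + 6 * R - 1)
        rw [show c * R + 6 * R - 1 + 1 = c * R + 1 * (6 * R) by omega, rp_add_mul_period, rp_of_lt (i := c * R) hcR] at this
        exact this.symm
      · rw [Nat.sub_add_cancel hj, hrpj]; exact hadj
    · -- `b = ringPt R (cR + 1)`: over the bond `(j, j+1)`
      refine ⟨j, ringPt R (c * R + 1), by omega, le_rfl, hb, ?_, ?_, Or.inl rfl⟩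
      · rw [hrpj]
        have := ringPt_adj_ringPt_pred_lo hR hc (t := 1) le_rfl (by omega)
        rwa [show c * (R - 1) + 1 - 1 = c * (R - 1) by omega] at this
      · rw [hsucc]; exact ringPt_adj_ringPt_pred_hi hR hc (t := 1) (by omega)

end Literature.Probability.Percolation

end
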